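import Mathlib
import HarnessLib
import Literature.Computability.AlgebraicComplexity.AsymptoticRankMatMul
import Summits.MatrixMultiplication.MatrixMultiplication.Theorems.OutsiderSandwichBlockRank
import Summits.MatrixMultiplication.MatrixMultiplication.Theorems.OutsiderSandwichBlockOneOperational
import Summits.MatrixMultiplication.MatrixMultiplication.Theorems.OutsiderSandwichTouchingPoints
import Summits.MatrixMultiplication.MatrixMultiplication.Theorems.OutsiderSandwichGluingGain

/-!
# Outsider sandwich — ATTAINMENT of the exchange exponent and RANK CALIBRATION of the leaf
# `BlockOneIsMM` (decomp-mm lens-4, g21, part 3/3)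

Continues `OutsiderSandwichGluingGain`.  `θ⋆ = exchangeExponent = sup_F logRatio F`
(`isLUB_exchangeExponent_logRatio`, g20), `logRatio F = θ₁(F) − gain F`.

1. **ATTAINMENT** (compactness of Strassen's spectrum, `OutsiderSandwichTouchingPoints`): some universal
   spectral point `F⋆` has **`logRatio F⋆ = θ⋆`** (`exists_extremal_point`) — a maximising sequence has a
   universal cluster point and `logRatio = log₂ψ[⟨2,2,2⟩] − log₂ψ[C₁]` is continuous on the closed region
   `{ψ ≥ 4 on both classes}`.  So the supremum of g20 is a MAXIMUM: `¬BlockOneIsMM ⟺ ∃F⋆` universal with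
   `logRatio F⋆ = θ⋆ > 0` (`not_blockOneIsMM_iff_extremal`) — the minimal counterexample may be taken
   extremal, and `θ⋆ = sup_F (θ₁(F) − gain F)` (`isLUB_exchangeExponent_gain`).
2. **RANK CALIBRATION** (Strassen duality for `R̃`, attained at a top point): **`2^ω ≤ 2^{θ⋆} · R̃(C₁)`**
   (`rpow_omega_le`), hence the bracket **`ω − log₂ R̃(C₁) ≤ θ⋆ ≤ ω − 2`** (`exchangeExponent_mem_Icc_rank`;
   numerically `θ⋆ ≥ ω − log₂ 6` from the tree's `R̃(C₁) ≤ R̲(C₁) = 6`), and **the leaf alone bounds ω by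
   a rank: `BlockOneIsMM ⟹ 2^ω ≤ R̃(C₁)`, `ω ≤ log₂ R̃(C₁)`** — any certificate `R̃(C₁) ≤ ρ` turns the
   ω-free leaf into the effective bound `ω ≤ log₂ ρ` (`ρ = 6` today: `2.585`; `ρ < 2^{2.37134} ≈ 5.175`
   would pass the current record).  With the s-direction aside `BlockBelowMM ⟹ R̃(C₁) ≤ 2^ω`:
   `BlockOneIsMM ∧ BlockBelowMM ⟹ R̃(C₁) = 2^ω`.

[Strassen1988, Thm. 2.3, Thm. 3.8]; [ChristandlVranaZuiddam2023, Prop. 1.6]; [Zuiddam2018, Thm. 2.15].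
-/

noncomputable section

open Filter Topology
open Literature.Computability.AlgebraicComplexity
open Summit.MatrixMultiplication.MatrixMultiplication.Theorems.OutsiderSandwichCoupling (coupling₁)
open Summit.MatrixMultiplication.MatrixMultiplication.Theorems.OutsiderSandwichEdgeRigidity
  (four_le_map_matMulTensor_two)
open Summit.MatrixMultiplication.MatrixMultiplication.Theorems.OutsiderSandwichExchangeExponent
open Summit.MatrixMultiplication.MatrixMultiplication.Theorems.OutsiderSandwichExchangeSpectral
open Summit.MatrixMultiplication.MatrixMultiplication.Theorems.OutsiderSandwichTouchingPoints
  (exists_universal_clusterPt le_of_mapClusterPt)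
open Summit.MatrixMultiplication.MatrixMultiplication.Theorems.OutsiderSandwichGluingGain

namespace Summit.MatrixMultiplication.MatrixMultiplication.Theorems.OutsiderSandwichGluingExtremal

variable {F : SpectralMap ℂ}

/-- **`θ⋆ = sup_F (θ₁(F) − gain F)`** (g20's spectral formula in gain form). [cite: Strassen1988, Thm. 3.8] -/
theorem isLUB_exchangeExponent_gain :
    IsLUB {x : ℝ | ∃ F : SpectralMap ℂ, IsUniversalSpectralPoint ℂ F ∧ specMMPoint ℂ F 1 - gain F = x}
      exchangeExponent := by
  have e : {x : ℝ | ∃ F : SpectralMap ℂ, IsUniversalSpectralPoint ℂ F ∧ specMMPoint ℂ F 1 - gain F = x} =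
      {x : ℝ | ∃ F : SpectralMap ℂ, IsUniversalSpectralPoint ℂ F ∧ logRatio F = x} := by
    ext x
    constructor
    · rintro ⟨F, hF, rfl⟩
      exact ⟨F, hF, logRatio_eq hF⟩
    · rintro ⟨F, hF, rfl⟩
      exact ⟨F, hF, (logRatio_eq hF).symm⟩
  rw [e]
  exact isLUB_exchangeExponent_logRatio

/-! ## 1. Attainment: the supremum `θ⋆` is a maximum -/

/-- The class `[⟨2,2,2⟩] ∈ T(ℂ)`. -/
private abbrev aMM : TensorClass ℂ := TensorClass.mk (matMulTensor ℂ 2 2 2)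
/-- The class `[C₁] ∈ T(ℂ)`. -/
private abbrev aC : TensorClass ℂ := TensorClass.mk coupling₁

/-- The closed region `{ψ | 4 ≤ ψ[⟨2,2,2⟩], 4 ≤ ψ[C₁]}` (contains every universal point). -/
private def regionE : Set (TensorClass ℂ → ℝ) := {ψ | 4 ≤ ψ aMM ∧ 4 ≤ ψ aC}

/-- `regionE` is closed. [folklore] -/
private theorem isClosed_regionE : IsClosed regionE :=
  (isClosed_le continuous_const (continuous_apply aMM)).inter
    (isClosed_le continuous_const (continuous_apply aC))

/-- Every universal point lies in `regionE` (`F⟨2,2,2⟩ ≥ 4`, `F(C₁) ≥ 4`). [cite: Strassen1991, Thm. 6.1] -/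
private theorem eval_mem_regionE (hF : IsUniversalSpectralPoint ℂ F) :
    TensorClass.eval F ∈ regionE := by
  refine ⟨?_, ?_⟩
  · show 4 ≤ TensorClass.eval F (TensorClass.mk (matMulTensor ℂ 2 2 2))
    rw [TensorClass.eval_mk hF]
    exact four_le_map_matMulTensor_two hF
  · show 4 ≤ TensorClass.eval F (TensorClass.mk coupling₁)
    rw [TensorClass.eval_mk hF]
    exact four_le_map_coupling₁ hF

/-- `ψ ↦ log₂ ψ(a)` is continuous where `ψ(a) > 0`. [folklore] -/
private theorem continuousOn_logb_apply (a : TensorClass ℂ) {D : Set (TensorClass ℂ → ℝ)}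
    (hD : ∀ ψ ∈ D, 0 < ψ a) :
    ContinuousOn (fun ψ : TensorClass ℂ → ℝ => Real.logb 2 (ψ a)) D := by
  have h1 : ContinuousOn (fun ψ : TensorClass ℂ → ℝ => ψ a) D := (continuous_apply a).continuousOn
  have h2 : ContinuousOn (fun ψ : TensorClass ℂ → ℝ => Real.log (ψ a)) D :=
    h1.log fun ψ hψ => (hD ψ hψ).ne'
  have e : (fun ψ : TensorClass ℂ → ℝ => Real.logb 2 (ψ a)) =
      fun ψ => Real.log (ψ a) / Real.log 2 := rfl
  rw [e]
  exact h2.div_const _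

/-- **ATTAINMENT: some universal spectral point `F⋆` has `logRatio F⋆ = θ⋆`** — a maximising sequence
(`isLUB_exchangeExponent_logRatio`) has a cluster point in Strassen's compact spectrum
(`exists_universal_clusterPt`), and `logRatio = log₂ψ[⟨2,2,2⟩] − log₂ψ[C₁]` is continuous there.
So `¬BlockOneIsMM ⟺ max_F logRatio F > 0`, the maximum attained. [cite: Strassen1988, Thm. 2.3] -/
theorem exists_extremal_point :
    ∃ F : SpectralMap ℂ, IsUniversalSpectralPoint ℂ F ∧ logRatio F = exchangeExponent := by
  -- a maximising sequence
  have hseq : ∀ n : ℕ, ∃ F : SpectralMap ℂ, IsUniversalSpectralPoint ℂ F ∧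
      exchangeExponent ≤ logRatio F + 1 / ((n : ℝ) + 1) := by
    intro n
    have hlt : exchangeExponent - 1 / ((n : ℝ) + 1) < exchangeExponent := by
      have : (0 : ℝ) < 1 / ((n : ℝ) + 1) := by positivity
      linarith
    obtain ⟨x, ⟨F, hF, rfl⟩, hx, -⟩ := isLUB_exchangeExponent_logRatio.exists_between hlt
    exact ⟨F, hF, by linarith⟩
  choose F hF hle using hseq
  obtain ⟨φ, -, hc, hU⟩ := exists_universal_clusterPt F hF
  have hD : ∀ n, (fun n => TensorClass.eval (F n)) n ∈ regionE := fun n => eval_mem_regionE (hF n)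
  have hmm : ∀ n, TensorClass.eval (F n) aMM = F n (matMulTensor ℂ 2 2 2) :=
    fun n => TensorClass.eval_mk (hF n) _
  have hcc : ∀ n, TensorClass.eval (F n) aC = F n coupling₁ :=
    fun n => TensorClass.eval_mk (hF n) _
  have hcontM : ContinuousOn (fun ψ : TensorClass ℂ → ℝ => Real.logb 2 (ψ aMM)) regionE :=
    continuousOn_logb_apply aMM fun _ hψ => lt_of_lt_of_le (by norm_num) hψ.1
  have hcontC : ContinuousOn (fun ψ : TensorClass ℂ → ℝ => Real.logb 2 (ψ aC)) regionE :=
    continuousOn_logb_apply aC fun _ hψ => lt_of_lt_of_le (by norm_num) hψ.2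
  -- pass `θ⋆ ≤ logRatio (F n) + 1/(n+1)` to the limit
  have hfg : ∀ n : ℕ, (fun _ : TensorClass ℂ → ℝ => exchangeExponent) (TensorClass.eval (F n)) ≤
      (fun ψ : TensorClass ℂ → ℝ => Real.logb 2 (ψ aMM) - Real.logb 2 (ψ aC))
        (TensorClass.eval (F n)) + 1 / ((n : ℝ) + 1) := by
    intro n
    show exchangeExponent ≤ Real.logb 2 (TensorClass.eval (F n) aMM) -
      Real.logb 2 (TensorClass.eval (F n) aC) + 1 / ((n : ℝ) + 1)
    rw [hmm, hcc, ← logRatio_eq_logb_sub (hF n)]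
    exact hle n
  have hlim : exchangeExponent ≤ Real.logb 2 (φ aMM) - Real.logb 2 (φ aC) :=
    le_of_mapClusterPt (f := fun _ : TensorClass ℂ → ℝ => exchangeExponent)
      (g := fun ψ : TensorClass ℂ → ℝ => Real.logb 2 (ψ aMM) - Real.logb 2 (ψ aC))
      hc isClosed_regionE hD continuousOn_const (hcontM.sub hcontC) hfg
  refine ⟨TensorClass.spectralMapOf φ, hU, le_antisymm (logRatio_le_exchangeExponent hU) ?_⟩
  rw [logRatio_eq_logb_sub hU, TensorClass.spectralMapOf_apply φ (matMulTensor ℂ 2 2 2),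
    TensorClass.spectralMapOf_apply φ coupling₁]
  exact hlim

/-- **The dichotomy with a witness**: `¬BlockOneIsMM ⟺ ∃` a universal `F⋆` with `logRatio F⋆ = θ⋆ > 0`.
[cite: Strassen1988, Thm. 2.3] -/
theorem not_blockOneIsMM_iff_extremal :
    ¬ Theses.OutsiderSandwich.BlockOneIsMM ↔
      ∃ F : SpectralMap ℂ, IsUniversalSpectralPoint ℂ F ∧ logRatio F = exchangeExponent ∧
        0 < logRatio F := by
  rw [not_blockOneIsMM_iff_exchangeExponent_pos]
  constructor
  · intro hpos
    obtain ⟨F, hF, hFe⟩ := exists_extremal_point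
    exact ⟨F, hF, hFe, hFe ▸ hpos⟩
  · rintro ⟨F, hF, hFe, hpos⟩
    rwa [hFe] at hpos

/-! ## 2. Rank calibration: `2^ω ≤ 2^{θ⋆} · R̃(C₁)` -/

/-- **`2^ω ≤ 2^{θ⋆} · R̃(C₁)`**: at an `R̃(⟨2,2,2⟩)`-attaining point (Strassen duality, attained)
`2^ω = F⟨2,2,2⟩ ≤ 2^{θ⋆} F(C₁) ≤ 2^{θ⋆} R̃(C₁)`. [cite: ChristandlVranaZuiddam2023, Prop. 1.6] -/
theorem rpow_omega_le :
    (2 : ℝ) ^ omega ℂ ≤ (2 : ℝ) ^ exchangeExponent * asymptoticRank coupling₁ := by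
  obtain ⟨G, hG, hGt⟩ := (strassen_duality_asymptoticRank_holds ℂ (matMulTensor ℂ 2 2 2)).2
  have hω : G (matMulTensor ℂ 2 2 2) = (2 : ℝ) ^ omega ℂ := by
    rw [hGt, asymptoticRank_matMulTensor ℂ 2 (by norm_num)]
    norm_num
  rw [← hω]
  calc G (matMulTensor ℂ 2 2 2) ≤ (2 : ℝ) ^ exchangeExponent * G coupling₁ :=
        spectralRatioLe_exchangeExponent G hG
    _ ≤ (2 : ℝ) ^ exchangeExponent * asymptoticRank coupling₁ :=
        mul_le_mul_of_nonneg_left ((strassen_duality_asymptoticRank_holds ℂ coupling₁).1 G hG)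
          (Real.rpow_nonneg (by norm_num) _)

/-- **`ω ≤ θ⋆ + log₂ R̃(C₁)`**, i.e. the LOWER bracket `ω − log₂ R̃(C₁) ≤ θ⋆` (tree: `θ⋆ ≤ ω − 2`).
[cite: ChristandlVranaZuiddam2023, Prop. 1.6] -/
theorem omega_le_exchangeExponent_add_logb :
    omega ℂ ≤ exchangeExponent + Real.logb 2 (asymptoticRank coupling₁) := by
  have hR : 0 < asymptoticRank coupling₁ :=
    lt_of_lt_of_le (by norm_num) OutsiderSandwichBlockRank.four_le_asymptoticRank_coupling₁
  have h := Real.logb_le_logb_of_le one_lt_two (Real.rpow_pos_of_pos two_pos _) rpow_omega_le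
  rw [Real.logb_rpow two_pos (by norm_num), Real.logb_mul (Real.rpow_pos_of_pos two_pos _).ne' hR.ne',
    Real.logb_rpow two_pos (by norm_num)] at h
  exact h

/-- **The bracket `ω − log₂ R̃(C₁) ≤ θ⋆ ≤ ω − 2`.** [cite: ChristandlVranaZuiddam2023, Prop. 1.6] -/
theorem exchangeExponent_mem_Icc_rank :
    exchangeExponent ∈ Set.Icc (omega ℂ - Real.logb 2 (asymptoticRank coupling₁)) (omega ℂ - 2) :=
  ⟨by linarith [omega_le_exchangeExponent_add_logb], exchangeExponent_le_omega_sub_two⟩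

/-- Numerically: `θ⋆ ≥ ω − log₂ 6` (`R̃(C₁) ≤ R̲(C₁) = 6`, `OutsiderSandwichBlockOneOperational`).
[cite: ChristandlVranaZuiddam2023, Prop. 1.6] -/
theorem omega_sub_logb_six_le_exchangeExponent :
    omega ℂ - Real.logb 2 6 ≤ exchangeExponent := by
  have hR : 0 < asymptoticRank coupling₁ :=
    lt_of_lt_of_le (by norm_num) OutsiderSandwichBlockRank.four_le_asymptoticRank_coupling₁
  have h6 := Real.logb_le_logb_of_le one_lt_two hR
    OutsiderSandwichBlockOneOperational.asymptoticRank_coupling₁_le_six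
  linarith [omega_le_exchangeExponent_add_logb]

/-- **THE LEAF ALONE BOUNDS ω BY A RANK: `BlockOneIsMM ⟹ 2^ω ≤ R̃(C₁)`.**
[cite: ChristandlVranaZuiddam2023, Prop. 1.6] -/
theorem rpow_omega_le_asymptoticRank_of_blockOneIsMM (h : Theses.OutsiderSandwich.BlockOneIsMM) :
    (2 : ℝ) ^ omega ℂ ≤ asymptoticRank coupling₁ := by
  have h0 : exchangeExponent = 0 := blockOneIsMM_iff_exchangeExponent_eq_zero.1 h
  have := rpow_omega_le
  rwa [h0, Real.rpow_zero, one_mul] at this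

/-- **`BlockOneIsMM ⟹ ω ≤ log₂ R̃(C₁)`** — any asymptotic-rank bound `R̃(C₁) ≤ ρ` makes the ω-free
leaf an effective exponent bound `ω ≤ log₂ ρ` (today `ρ = 6`: `ω ≤ 2.585`; `ρ < 2^{2.37134}` would pass
the current record). [cite: ChristandlVranaZuiddam2023, Prop. 1.6] -/
theorem omega_le_logb_asymptoticRank_of_blockOneIsMM (h : Theses.OutsiderSandwich.BlockOneIsMM) :
    omega ℂ ≤ Real.logb 2 (asymptoticRank coupling₁) := by
  have h0 : exchangeExponent = 0 := blockOneIsMM_iff_exchangeExponent_eq_zero.1 h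
  have := omega_le_exchangeExponent_add_logb
  rwa [h0, zero_add] at this

/-- **`BlockOneIsMM ∧ R̃(C₁) ≤ ρ ⟹ ω ≤ log₂ ρ`.** [cite: ChristandlVranaZuiddam2023, Prop. 1.6] -/
theorem omega_le_logb_of_blockOneIsMM_of_rank_le (h : Theses.OutsiderSandwich.BlockOneIsMM) {ρ : ℝ}
    (hρ : asymptoticRank coupling₁ ≤ ρ) : omega ℂ ≤ Real.logb 2 ρ := by
  have hR : 0 < asymptoticRank coupling₁ :=
    lt_of_lt_of_le (by norm_num) OutsiderSandwichBlockRank.four_le_asymptoticRank_coupling₁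
  exact (omega_le_logb_asymptoticRank_of_blockOneIsMM h).trans
    (Real.logb_le_logb_of_le one_lt_two hR hρ)

/-- **Both ω-free one-block statements pin the rank: `BlockOneIsMM ∧ BlockBelowMM ⟹ R̃(C₁) = 2^ω`**
(with the tree's `BlockBelowMM ⟹ R̃(C₁) ≤ 2^ω`). [cite: ChristandlVranaZuiddam2023, Prop. 1.6] -/
theorem asymptoticRank_eq_of_blockOneIsMM_of_blockBelowMM (h : Theses.OutsiderSandwich.BlockOneIsMM)
    (h' : Theses.OutsiderSandwich.BlockBelowMM) :
    asymptoticRank coupling₁ = (2 : ℝ) ^ omega ℂ :=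
  le_antisymm (OutsiderSandwichBlockRank.asymptoticRank_coupling₁_le_of_blockBelowMM h')
    (rpow_omega_le_asymptoticRank_of_blockOneIsMM h)

end Summit.MatrixMultiplication.MatrixMultiplication.Theorems.OutsiderSandwichGluingExtremal

end
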